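import Literature.NumberTheory.LFunctions.Zhang2022.RepairStructuralBarrier
import Literature.NumberTheory.LFunctions.Zhang2022.RepairFrakc3S
import Literature.NumberTheory.LFunctions.Zhang2022.RepairCrossFormDictionary
import Literature.NumberTheory.LFunctions.Zhang2022.RepairTentForm
import Literature.NumberTheory.LFunctions.Zhang2022.RepairBarrierAssembly

/-!
# Zhang (2022) §18-margin repair rung — THE VERDICT ASSEMBLY [Q2-1]: for every admissible design,
# `¬ (C₂₃₂(θ)·C₂₃₃(θ) < |𝔡+𝔡′|²(θ))` — NOT-REPAIRABLE-IN-CLASS, with `AdmissibleTheta θ` as the only hypothesis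

Trunk T-ANT (NumberTheory/LFunctions). Y. Zhang, *Discrete mean estimates and the Landau–Siegel
zero*, arXiv:2211.02515v1 (2022) [Zhang2022LandauSiegel] — **an unrefereed manuscript under
adjudication; nothing here asserts or denies its Theorems 1–2 or any analytic lemma; no claim about
Landau–Siegel zeros is made. The statement below is about the manuscript's METHOD AS ARCHITECTED (the
class `R` of designs `θ`), not about zeros of `L`-functions.** Rung F-S1R (human ruling D-0077),
RULING R3 (verdict currency = the JOINT criterion T-true of the §2 endgame; architecture STRUCTURAL),
ASSIGNMENTS v2 K-S4: statement = p4 (`RepairStructuralBarrier`), assembly = p6 (this file).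

The §2 endgame of the manuscript (Propositions 2.4–2.6 with (2.32)–(2.33), p. 11) needs, at main
order, `C₂₃₂·C₂₃₃ < |𝔡′+𝔡|²` (`Section2MainOrder.MainOrderContradiction` at the printed design). For a
design `θ = (ν₁,ν₂,ν₃; k₁,k₂,k₃; ι₂,ι₃,ι₄; cut₁)` of the class `Repair.AdmissibleTheta` (p4, CLASS R v1
of record) the three main-order functionals OF RECORD are

* `C232S θ` — the (2.32)-side `𝔠₁ + 𝔠₂ + 2Re 𝔠₃` with the EXACT bilinear `𝔠₃` (ruling R2/D2a; p1
  `RepairFrakc3S`: `C232S θ = 𝔅(𝔤_θ, 𝔤_θ)` for the glued `H`-profile `𝔤_θ = g₁ + R̃g₂` — `C232S_eq_form`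
  (K-S2) — and `C232S θ = Re 𝔠₁(θ) + Re 𝔠₂(θ) + 2Re 𝔠₃ˢ(θ)` with p2's K-S1 Gram identities
  `frakc1T/frakc2T_eq_mainTermForm`, `C232S_eq_frakc`);
* `C233T θ` — the (2.33)-side constant (p3 `RepairSection10Theta`), `= 𝔅(f_θ, f_θ)` for the tent `f_θ`
  (p3 `RepairTentForm.mainTermForm_tentT_eq_C233T`, K-S1/tent);
* `dSumS θ` — the cross main term `𝔡 + 𝔡′` of (10.1)/(10.17) (p3 `RepairCrossFormDictionary`),
  `= P(𝔤_θ, f_θ)` (`dSumS_eq_polar`, K-S3).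

Plugging these identities and the `H¹` witnesses (`gluedS_isH1`, `isH1_tentT`) into p4's
`Repair.not_repairable_true_need_of_dictionary` (Cauchy–Schwarz for the ONE positive semidefinite form
`𝔅`, `MainTermFormCauchySchwarz.norm_sq_mainTermFormPolar_le`) gives the verdict theorem with
`AdmissibleTheta θ` as its ONLY hypothesis:

* **`not_repairable_true_need : ∀ θ, AdmissibleTheta θ → ¬ (C232S θ * C233T θ < ‖dSumS θ‖ ^ 2)`** [Q2-1];
* `normSq_dSumS_le : ‖dSumS θ‖² ≤ C232S θ · C233T θ`; `not_sqrt_closing_in_class` (the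
  `MainOrderContradiction` shape `√(C₂₃₂C₂₃₃) < |𝔡′+𝔡|`); `not_repairable_true_need_frakc` (the same with
  `C232S` displayed as `Re 𝔠₁ + Re 𝔠₂ + 2Re 𝔠₃ˢ`); `trueNeed_ratio_le_one_in_class`;
* **`not_printed_chain_in_class`** [Q2-1b]: no admissible design has `C₂₃₂ < 0.001 ∧ C₂₃₃ < 3000 ∧ |𝔡′+𝔡|² > 25`
  (the printed (2.32), (2.33), Prop. 2.4 cannot hold together: `0.001·3000 = 3 < 25`);
* [Q2-6] `0 ≤ C232S θ` is p1's `C232S_nonneg` (re-exported as `margin_nonneg_in_class` through p4's shape).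

So: **within the class as architected — any lengths `ν₃ < ν₂ ≤ ½ < ν₁ < 1` with `ν₁ + ν₃ > 1`, any shifts
`0 < k₁ = k₃, k₂ < 5`, any `ι ∈ ℂ³`, cut at `½` — no choice of parameters makes the §2 endgame close at main
order.** The only analytic inputs are the kernel-proved form calculus of the tree (`MainTermForm*`) and the
dictionary identities K-S1–K-S3; no numerics, no new `Prop` facts. The printed point is the instance
`θ₀` (`Section2MainOrder.not_mainOrderContradiction_all`, certified numerically long before); the local
numerical annex (T-print/T-chain floors near `θ₀`) lives in `RepairTiePoints(Cert)` / `RepairTieSegment`.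

## References

* Y. Zhang, arXiv:2211.02515v1 (2022), §2 Props. 2.4–2.6, (2.18), (2.32)–(2.33) [p. 10–11], §8 (8.23),
  §9 (9.7), §10 (10.1), (10.17), §§12–17, §18 (18.1)–(18.3) [p. 99–101].
  [cite: Zhang2022LandauSiegel, §§2, 8–10, 12–18]
-/

noncomputable section

open Real Complex ComplexConjugate
open scoped ComplexOrder

namespace Literature.NumberTheory.LFunctions.Zhang2022

namespace Repair

variable {θ : Theta}

/-! ### The class implies the profile side conditions -/

/-- length bounds extracted from the class: `ν₂ < ν₁`, `0 ≤ ν₂`, `ν₁ ≤ 1`.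
[cite: Zhang2022LandauSiegel, §2 (2.21)–(2.28)] -/
theorem AdmissibleTheta.assembly_bounds (h : AdmissibleTheta θ) : θ.nu2 < θ.nu1 ∧ 0 ≤ θ.nu2 ∧ θ.nu1 ≤ 1 := by
  obtain ⟨⟨h32, h21⟩, -, h1, h13, -, -, -⟩ := h
  unfold Theta.belowP at h1
  unfold Theta.dualRangesNonempty at h13
  exact ⟨h21, by linarith, h1.le⟩

/-- K-S4 hypothesis `hfp`: the tent `f_θ` is an `H¹` profile on the class (p3 `isH1_tentT`).
[cite: Zhang2022LandauSiegel, §2 (2.28)] -/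
theorem tent_isH1_on_class : ∀ θ, AdmissibleTheta θ → IsH1OnUnitInterval (tentT θ) (tentT' θ) :=
  fun _ h => isH1_tentT h.assembly_bounds.1

/-- K-S4 hypothesis `hgl`: the glued `H`-profile `𝔤_θ` is `H¹` on the class (p1 `gluedS_isH1`).
[cite: Zhang2022LandauSiegel, §2 (2.23)–(2.27)] -/
theorem glued_isH1_on_class : ∀ θ, AdmissibleTheta θ → IsH1OnUnitInterval (gluedS θ) (gluedS' θ) :=
  fun _ h => gluedS_isH1 h

/-- K-S4 hypothesis `h232` (K-S2, p1): `C232S θ = 𝔅(𝔤_θ, 𝔤_θ)` (definitional). [cite: Zhang2022LandauSiegel, §18 (18.1), (2.32)] -/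
theorem h232_on_class : ∀ θ, AdmissibleTheta θ → C232S θ = mainTermForm (gluedS θ) (gluedS' θ) :=
  fun θ _ => C232S_eq_form θ

/-- K-S4 hypothesis `h233` (K-S1 tent, p3): `C233T θ = 𝔅(f_θ, f_θ)` on the class.
[cite: Zhang2022LandauSiegel, §10 (10.19), §18 (18.3), (2.33)] -/
theorem h233_on_class : ∀ θ, AdmissibleTheta θ → C233T θ = mainTermForm (tentT θ) (tentT' θ) :=
  fun _ h => (mainTermForm_tentT_eq_C233T h.assembly_bounds.1 h.assembly_bounds.2.1 h.assembly_bounds.2.2).symm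

/-- K-S4 hypothesis `hsum` (K-S3, p3): `dSumS θ = P(𝔤_θ, f_θ)` on the class (`dSumS_eq_polar`; p1's
`gluedS` IS p3's glued lambda, definitionally). [cite: Zhang2022LandauSiegel, §10 (10.1), (10.17)] -/
theorem hsum_on_class : ∀ θ, AdmissibleTheta θ →
    dSumS θ = mainTermFormPolar (gluedS θ) (gluedS' θ) (tentT θ) (tentT' θ) :=
  fun _ h => dSumS_eq_polar h

/-! ### [Q2-1] The verdict theorem -/

/-- **NOT-REPAIRABLE-IN-CLASS [Q2-1].** For every design `θ` of the admissible class `R`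
(`Repair.AdmissibleTheta`: `ν₃ < ν₂ ≤ ½ = cut₁ < ν₁ < 1`, `ν₁ + ν₃ > 1`, `0 < k₁ = k₃ < 5`, `0 < k₂ < 5`,
any `ι₂, ι₃, ι₄ ∈ ℂ`), the joint main-order criterion of the §2 endgame FAILS:
`¬ (C₂₃₂(θ) · C₂₃₃(θ) < |𝔡(θ) + 𝔡′(θ)|²)`, where `C₂₃₂ = Re 𝔠₁ + Re 𝔠₂ + 2Re 𝔠₃` is the (2.32)-side
constant with the exact bilinear `𝔠₃` (`C232S`), `C₂₃₃` the (2.33)-side constant (`C233T`) and `𝔡 + 𝔡′`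
the cross main term of (10.17) (`dSumS`) — by Cauchy–Schwarz for the manuscript's one positive
semidefinite main-term form `𝔅` (p4 `not_repairable_true_need_of_dictionary`) and the dictionary
identities K-S1 (p2), K-S2 (p1), K-S3 (p3). A statement about the method's main terms over the class
as architected; nothing about Theorems 1–2 or about zeros. [cite: Zhang2022LandauSiegel, §2 Props. 2.4–2.6, (2.32)–(2.33)] -/
theorem not_repairable_true_need :
    ∀ θ, AdmissibleTheta θ → ¬ (C232S θ * C233T θ < ‖dSumS θ‖ ^ 2) :=
  not_repairable_true_need_of_dictionary C232S C233T dSumS gluedS gluedS' (fun θ => tentT θ)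
    (fun θ => tentT' θ) glued_isH1_on_class tent_isH1_on_class h232_on_class h233_on_class hsum_on_class

/-- **Cauchy–Schwarz on the class**: `|𝔡 + 𝔡′|²(θ) ≤ C₂₃₂(θ)·C₂₃₃(θ)` for every admissible `θ`.
[cite: Zhang2022LandauSiegel, §2 after (2.33)] -/
theorem normSq_dSumS_le : ∀ θ, AdmissibleTheta θ → ‖dSumS θ‖ ^ 2 ≤ C232S θ * C233T θ :=
  normSq_dSum_le_of_domination glued_isH1_on_class tent_isH1_on_class
    (fun θ h => (h232_on_class θ h).symm.le) (fun θ h => (h233_on_class θ h).symm.le)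
    (fun θ h => (hsum_on_class θ h).symm ▸ le_rfl)

/-- **the `MainOrderContradiction` shape**: `¬ (√(C₂₃₂(θ)C₂₃₃(θ)) < |𝔡 + 𝔡′|(θ))` on the class (at the
printed design this is `Section2MainOrder.not_mainOrderContradiction_all`, certified numerically; here for
EVERY admissible design, structurally). [cite: Zhang2022LandauSiegel, §2 after (2.33)] -/
theorem not_sqrt_closing_in_class :
    ∀ θ, AdmissibleTheta θ → ¬ (Real.sqrt (C232S θ * C233T θ) < ‖dSumS θ‖) :=
  not_sqrt_closing_of_domination glued_isH1_on_class tent_isH1_on_class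
    (fun θ h => (h232_on_class θ h).symm.le) (fun θ h => (h233_on_class θ h).symm.le)
    (fun θ h => (hsum_on_class θ h).symm ▸ le_rfl)

/-- **the verdict with `C₂₃₂` displayed through the three feeders**: for every admissible `θ`,
`¬ ((Re 𝔠₁(θ) + Re 𝔠₂(θ) + 2Re 𝔠₃ˢ(θ)) · C₂₃₃(θ) < |𝔡 + 𝔡′|²(θ))` (`𝔠₁, 𝔠₂` = p4's `frakc1T/frakc2T`
(8.23)/(9.7) — 𝔅-values by p2's K-S1; `𝔠₃ˢ` = p1's exact bilinear slot). [cite: Zhang2022LandauSiegel, (8.23), (9.7), (18.1), (2.32)–(2.33)] -/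
theorem not_repairable_true_need_frakc : ∀ θ, AdmissibleTheta θ →
    ¬ (((frakc1T θ).re + (frakc2T θ).re + 2 * (frakc3S θ).re) * C233T θ < ‖dSumS θ‖ ^ 2) := by
  intro θ h
  rw [← C232S_eq_frakc h]
  exact not_repairable_true_need θ h

/-- **the variational form**: `|𝔡 + 𝔡′|² / (C₂₃₂C₂₃₃) ≤ 1` on the class (the method's "Rayleigh quotient"
never exceeds the Cauchy–Schwarz value `1`; at the printed design it is `≈ 0.19`, on the twist ridge
`k₁ = k₂` it approaches `1⁻`, cf. REPAIR-LEDGER P6b/P6c). [cite: Zhang2022LandauSiegel, §2 after (2.33)] -/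
theorem trueNeed_ratio_le_one_in_class :
    ∀ θ, AdmissibleTheta θ → ‖dSumS θ‖ ^ 2 / (C232S θ * C233T θ) ≤ 1 := by
  intro θ h
  rw [h232_on_class θ h, h233_on_class θ h, hsum_on_class θ h]
  exact trueNeed_ratio_le_one (glued_isH1_on_class θ h) (tent_isH1_on_class θ h)

/-! ### [Q2-1b] the printed chain and [Q2-6] non-negativity -/

/-- **[Q2-1b] PRINTED-TRIPLE INFEASIBILITY on the class.** No admissible design has
`C₂₃₂ < 0.001` ((2.32)) AND `C₂₃₃ < 3000` ((2.33)) AND `|𝔡+𝔡′|² > 25` (Proposition 2.4) at main order —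
the §2 chain (T-chain) is not re-instantiable anywhere in `R`. [cite: Zhang2022LandauSiegel, §2 Props. 2.4–2.5, (2.32)–(2.33)] -/
theorem not_printed_chain_in_class :
    ∀ θ, AdmissibleTheta θ → ¬ (C232S θ < 1 / 1000 ∧ C233T θ < 3000 ∧ 25 < ‖dSumS θ‖ ^ 2) :=
  not_printed_chain_of_dictionary C232S C233T dSumS gluedS gluedS' (fun θ => tentT θ) (fun θ => tentT' θ)
    glued_isH1_on_class tent_isH1_on_class h232_on_class h233_on_class hsum_on_class

/-- **[Q2-6] T-zero is impossible in class**: `0 ≤ C₂₃₂(θ)` for every admissible `θ` (= p1's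
`C232S_nonneg`, here through p4's `margin_nonneg_of_dictionary`). [cite: Zhang2022LandauSiegel, §2 (2.32), Lemma 2.3] -/
theorem margin_nonneg_in_class : ∀ θ, AdmissibleTheta θ → 0 ≤ C232S θ :=
  margin_nonneg_of_dictionary C232S gluedS gluedS' glued_isH1_on_class h232_on_class

/-- the same three conclusions in the currency of the TRANSCRIBED reading: `C232S = C232D + 2Re(discS)`
(p1 `C232S_eq_C232D_add`; `discS` = the exact-minus-transcribed `𝔠₃` discrepancy of record, `2.2·10⁻⁶`
at `θ₀`) — so the verdict for the transcribed functional `C232D` reads with the explicit two-sided slot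
`2Re discS(θ)`. [cite: Zhang2022LandauSiegel, §12 (12.13)–(12.17), §18 (18.1)] -/
theorem not_repairable_true_need_transcribed : ∀ θ, AdmissibleTheta θ →
    ¬ ((C232D θ + 2 * (discS θ).re) * C233T θ < ‖dSumS θ‖ ^ 2) := by
  intro θ h
  rw [← C232S_eq_C232D_add h]
  exact not_repairable_true_need θ h

/-! ### The printed point is a member of the class: the structural verdict covers `θ₀` and the
printed `ι`-family (whose numerical instance is `Section2AllIota.not_mainOrderContradictionG_all`) -/

/-- at the printed design `θ₀` and on the whole printed `ι`-family the structural verdict applies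
(`admissible_theta0`, `admissible_thetaIota`). [cite: Zhang2022LandauSiegel, §2 (2.21)–(2.26)] -/
theorem not_repairable_true_need_thetaIota (w2 w3 w4 : ℂ) :
    ¬ (C232S (thetaIota w2 w3 w4) * C233T (thetaIota w2 w3 w4) < ‖dSumS (thetaIota w2 w3 w4)‖ ^ 2)
    ∧ ¬ (C232S theta0 * C233T theta0 < ‖dSumS theta0‖ ^ 2) :=
  ⟨not_repairable_true_need _ (admissible_thetaIota w2 w3 w4), not_repairable_true_need _ admissible_theta0⟩

end Repair

end Literature.NumberTheory.LFunctions.Zhang2022
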